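import Mathlib

/-!
# Narrow windows from the pointwise law (crux `FanDecorrelation`, line `SketchIdeator5`)

Stub `stub_narrowOfPointwise` of the crux `FanDecorrelation`
(`Summit.Parity.GeneralizedHardyLittlewood.Theses.LiouvilleMAD`), line `SketchIdeator5`.

Notation (informal; nothing is defined in this file, every statement is written out over Mathlib):
`Q = ⌊√M⌋ + 1 = (Nat.sqrt M : ℝ) + 1`, `λ = ArithmeticFunction.liouville`, and for a lag `h : ℤ`
`D(h) = Σ_{(m,m') ∈ (M,2M]², m − m' = h} λ(mn+c) λ(m'n'+c)`.

`stub_narrowOfPointwise`: the POINTWISE law (`|D(h)| ≤ C₀ M^{1−κ}` for every single lag `h`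
with `2|h| ≥ Q`, `1 ≤ n ≠ n' ≤ 2M`) implies the height law for smooth lag windows
`φ((j − P)/D)` of NARROW width: for every smooth `φ` supported in `[−2,2]` and `c ≠ 0` there are
`δ > 0`, `ϑ < 1/4`, `C` with `|Σ_{j ∈ [1,2M]} φ((j−P)/D) · D(kj)| ≤ C · M^{3/4+ϑ}` whenever
`1 ≤ D ≤ M^{δ}`, `8D ≤ Q ≤ P ≤ 2Q`, `k ≠ 0`, `1 ≤ n ≠ n' ≤ 2M`.

Proof: `δ = κ/2`, `ϑ = 1/4 − κ/2`, `C = 6 ‖φ‖_∞ max(C₀,0)`.  The summands vanish unless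
`|j − P| ≤ 2D`; those `j` number at most `4D + 2 ≤ 6D ≤ 6M^{δ}`, and each has
`2|kj| ≥ 2j ≥ 2P − 4D ≥ Q`, so the pointwise law bounds its term by `‖φ‖_∞ C₀ M^{1−κ}`;
finally `M^{δ} · M^{1−κ} = M^{3/4+ϑ}`.
-/

namespace Summit.Parity.GeneralizedHardyLittlewood.Theorems.FanDecorrelation.NarrowOfPointwise

/-- A continuous function vanishing outside `[-2, 2]` is bounded: there is `B ≥ 0` with
`|φ x| ≤ B` for all `x`. [folklore] -/
theorem exists_abs_le_of_support_subset {φ : ℝ → ℝ} (hφ : Continuous φ)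
    (hsupp : ∀ x : ℝ, φ x ≠ 0 → |x| ≤ 2) : ∃ B : ℝ, 0 ≤ B ∧ ∀ x : ℝ, |φ x| ≤ B := by
  have hcs : HasCompactSupport φ := by
    refine HasCompactSupport.of_support_subset_isCompact
      (isCompact_Icc : IsCompact (Set.Icc (-2 : ℝ) 2)) ?_
    intro x hx
    exact Set.mem_Icc.mpr (abs_le.mp (hsupp x hx))
  obtain ⟨B, hB⟩ := hφ.bounded_above_of_compact_support hcs
  refine ⟨max B 0, le_max_right _ _, fun x => ?_⟩
  have h := hB x
  rw [Real.norm_eq_abs] at h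
  exact h.trans (le_max_left _ _)

/-- Counting naturals in a real window: for `0 ≤ D`, the `j ∈ s` with `|j - P| ≤ 2D` number at
most `4D + 2` (they lie in `[⌊P − 2D⌋₊, ⌊P − 2D⌋₊ + ⌊4D⌋₊ + 1]`). [folklore] -/
theorem card_filter_abs_sub_le (s : Finset ℕ) (P D : ℝ) (hD : 0 ≤ D) :
    ((s.filter (fun j : ℕ => |(j : ℝ) - P| ≤ 2 * D)).card : ℝ) ≤ 4 * D + 2 := by
  have hsub : s.filter (fun j : ℕ => |(j : ℝ) - P| ≤ 2 * D) ⊆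
      Finset.Icc ⌊P - 2 * D⌋₊ (⌊P - 2 * D⌋₊ + (⌊4 * D⌋₊ + 1)) := by
    intro j hj
    rw [Finset.mem_filter] at hj
    obtain ⟨hlo, hhi⟩ := abs_le.mp hj.2
    rw [Finset.mem_Icc]
    constructor
    · have h : ⌊P - 2 * D⌋₊ ≤ ⌊((j : ℕ) : ℝ)⌋₊ := Nat.floor_le_floor (by linarith)
      simpa using h
    · have h1 : P - 2 * D < (⌊P - 2 * D⌋₊ : ℝ) + 1 := Nat.lt_floor_add_one _
      have h2 : 4 * D < (⌊4 * D⌋₊ : ℝ) + 1 := Nat.lt_floor_add_one _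
      have h3 : (j : ℝ) < (⌊P - 2 * D⌋₊ : ℝ) + ((⌊4 * D⌋₊ : ℝ) + 1) + 1 := by linarith
      have h4 : j < ⌊P - 2 * D⌋₊ + (⌊4 * D⌋₊ + 1) + 1 := by exact_mod_cast h3
      omega
  calc ((s.filter (fun j : ℕ => |(j : ℝ) - P| ≤ 2 * D)).card : ℝ)
      ≤ ((Finset.Icc ⌊P - 2 * D⌋₊ (⌊P - 2 * D⌋₊ + (⌊4 * D⌋₊ + 1))).card : ℝ) := by
        exact_mod_cast Finset.card_le_card hsub
    _ = (⌊4 * D⌋₊ : ℝ) + 2 := by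
        rw [Nat.card_Icc, show ⌊P - 2 * D⌋₊ + (⌊4 * D⌋₊ + 1) + 1 - ⌊P - 2 * D⌋₊ =
          ⌊4 * D⌋₊ + 2 by omega]
        push_cast
        ring
    _ ≤ 4 * D + 2 := by
        have h := Nat.floor_le (by linarith : (0 : ℝ) ≤ 4 * D)
        linarith

/-- **Narrow windows from the pointwise law** (stub `stub_narrowOfPointwise` of line
`SketchIdeator5` of the crux `FanDecorrelation`).  Hypothesis: the pointwise power saving
`|D(h)| ≤ C₀ M^{1−κ}` for every lag `h` with `2|h| ≥ ⌊√M⌋ + 1` (and `1 ≤ n ≠ n' ≤ 2M`).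
Conclusion: for every smooth `φ` supported in `[−2,2]` and every `c ≠ 0` there are `δ > 0`,
`ϑ < 1/4` and `C` with `|Σ_{j ∈ [1,2M]} φ((j−P)/D) · D(kj)| ≤ C · M^{3/4+ϑ}` whenever
`1 ≤ D ≤ M^{δ}`, `8D ≤ ⌊√M⌋ + 1 ≤ P ≤ 2(⌊√M⌋ + 1)`, `k ≠ 0`, `1 ≤ n ≠ n' ≤ 2M`.
Choice: `δ = κ/2`, `ϑ = 1/4 − κ/2`; at most `6M^{δ}` summands survive, each bounded by
`‖φ‖_∞ · max(C₀,0) · M^{1−κ}` since its lag `kj` has `2|kj| ≥ 2j ≥ 2P − 4D ≥ ⌊√M⌋ + 1`.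
[folklore] -/
theorem stub_narrowOfPointwise :
    (∀ c : ℤ, c ≠ 0 → ∃ κ : ℝ, 0 < κ ∧ ∃ C : ℝ, ∀ M n n' : ℕ, ∀ h : ℤ,
      1 ≤ n → 1 ≤ n' → n ≠ n' → n ≤ 2 * M → n' ≤ 2 * M →
        (Nat.sqrt M : ℤ) + 1 ≤ 2 * |h| →
          |∑ p ∈ (Finset.Ioc M (2 * M) ×ˢ Finset.Ioc M (2 * M)).filter
                (fun p : ℕ × ℕ => (p.1 : ℤ) - p.2 = h),
              (ArithmeticFunction.liouville (Int.toNat ((p.1 : ℤ) * n + c)) : ℝ) *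
                (ArithmeticFunction.liouville (Int.toNat ((p.2 : ℤ) * n' + c)) : ℝ)| ≤
            C * (M : ℝ) ^ (1 - κ)) →
    ∀ φ : ℝ → ℝ, ContDiff ℝ (⊤ : ℕ∞) φ → (∀ x : ℝ, φ x ≠ 0 → |x| ≤ 2) →
      ∀ c : ℤ, c ≠ 0 → ∃ δ : ℝ, 0 < δ ∧ ∃ ϑ : ℝ, ϑ < 1 / 4 ∧ ∃ C : ℝ,
        ∀ M n n' : ℕ, ∀ k : ℤ, ∀ P D : ℝ,
          1 ≤ n → 1 ≤ n' → n ≠ n' → n ≤ 2 * M → n' ≤ 2 * M → k ≠ 0 →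
            1 ≤ D → D ≤ (M : ℝ) ^ δ → 8 * D ≤ (Nat.sqrt M : ℝ) + 1 →
              (Nat.sqrt M : ℝ) + 1 ≤ P → P ≤ 2 * ((Nat.sqrt M : ℝ) + 1) →
                |∑ j ∈ Finset.Icc 1 (2 * M), φ (((j : ℝ) - P) / D) *
                    ∑ p ∈ (Finset.Ioc M (2 * M) ×ˢ Finset.Ioc M (2 * M)).filter
                        (fun p : ℕ × ℕ => (p.1 : ℤ) - p.2 = k * (j : ℤ)),
                      (ArithmeticFunction.liouville (Int.toNat ((p.1 : ℤ) * n + c)) : ℝ) *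
                        (ArithmeticFunction.liouville (Int.toNat ((p.2 : ℤ) * n' + c)) : ℝ)| ≤
                  C * (M : ℝ) ^ (3 / 4 + ϑ) := by
  intro hpt φ hφ hsupp c hc
  obtain ⟨κ, hκ, C₀, hC₀⟩ := hpt c hc
  obtain ⟨B, hB0, hB⟩ := exists_abs_le_of_support_subset hφ.continuous hsupp
  refine ⟨κ / 2, by linarith, 1 / 4 - κ / 2, by linarith, 6 * B * max C₀ 0, ?_⟩
  intro M n n' k P D hn hn' hnn' hnM hn'M hk hD1 hDM hDQ hQP _
  have hM1 : (1 : ℝ) ≤ (M : ℝ) := by exact_mod_cast (show 1 ≤ M by omega)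
  have hM0 : (0 : ℝ) < (M : ℝ) := by linarith
  have hD0 : (0 : ℝ) < D := by linarith
  have hC₀' : (0 : ℝ) ≤ max C₀ 0 := le_max_right _ _
  -- name the inner correlation sum `T j = D(kj)`
  obtain ⟨T, hT⟩ : ∃ T : ℕ → ℝ, ∀ j : ℕ, T j =
      ∑ p ∈ (Finset.Ioc M (2 * M) ×ˢ Finset.Ioc M (2 * M)).filter
          (fun p : ℕ × ℕ => (p.1 : ℤ) - p.2 = k * (j : ℤ)),
        (ArithmeticFunction.liouville (Int.toNat ((p.1 : ℤ) * n + c)) : ℝ) *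
          (ArithmeticFunction.liouville (Int.toNat ((p.2 : ℤ) * n' + c)) : ℝ) :=
    ⟨_, fun _ => rfl⟩
  simp only [← hT]
  -- the pointwise law at the lag `kj`, for every `j` with `2j ≥ Q`
  have hTj : ∀ j : ℕ, (Nat.sqrt M : ℝ) + 1 ≤ 2 * (j : ℝ) →
      |T j| ≤ max C₀ 0 * (M : ℝ) ^ (1 - κ) := by
    intro j hj
    have hlag : (Nat.sqrt M : ℤ) + 1 ≤ 2 * |k * (j : ℤ)| := by
      have h1 : (Nat.sqrt M : ℤ) + 1 ≤ 2 * (j : ℤ) := by exact_mod_cast hj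
      have h2 : (1 : ℤ) ≤ |k| := Int.one_le_abs hk
      have h3 : |k * (j : ℤ)| = |k| * (j : ℤ) := by
        rw [abs_mul, abs_of_nonneg (by positivity : (0 : ℤ) ≤ (j : ℤ))]
      have h4 : (0 : ℤ) ≤ (j : ℤ) := by positivity
      nlinarith
    rw [hT]
    exact (hC₀ M n n' (k * (j : ℤ)) hn hn' hnn' hnM hn'M hlag).trans
      (mul_le_mul_of_nonneg_right (le_max_left _ _) (Real.rpow_nonneg hM0.le _))
  -- the window: summands vanish unless `|j - P| ≤ 2D`
  set S := (Finset.Icc 1 (2 * M)).filter (fun j : ℕ => |(j : ℝ) - P| ≤ 2 * D) with hS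
  have hsum : ∑ j ∈ Finset.Icc 1 (2 * M), φ (((j : ℝ) - P) / D) * T j =
      ∑ j ∈ S, φ (((j : ℝ) - P) / D) * T j := by
    rw [hS]
    refine (Finset.sum_filter_of_ne fun j _ hne => ?_).symm
    have hφne : φ (((j : ℝ) - P) / D) ≠ 0 := left_ne_zero_of_mul hne
    have h := hsupp _ hφne
    rwa [abs_div, abs_of_pos hD0, div_le_iff₀ hD0] at h
  -- termwise bound on the window
  have hterm : ∀ j ∈ S, |φ (((j : ℝ) - P) / D) * T j| ≤
      B * (max C₀ 0 * (M : ℝ) ^ (1 - κ)) := by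
    intro j hj
    rw [hS, Finset.mem_filter] at hj
    obtain ⟨hlo, _⟩ := abs_le.mp hj.2
    have hj2 : (Nat.sqrt M : ℝ) + 1 ≤ 2 * (j : ℝ) := by linarith
    rw [abs_mul]
    exact mul_le_mul (hB _) (hTj j hj2) (abs_nonneg _) hB0
  -- at most `4D + 2 ≤ 6D ≤ 6 M^δ` lags in the window
  have hcard : (S.card : ℝ) ≤ 6 * (M : ℝ) ^ (κ / 2) := by
    have h : (S.card : ℝ) ≤ 4 * D + 2 := by
      rw [hS]
      exact card_filter_abs_sub_le _ P D hD0.le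
    linarith
  have hpow : (M : ℝ) ^ (3 / 4 + (1 / 4 - κ / 2)) = (M : ℝ) ^ (κ / 2) * (M : ℝ) ^ (1 - κ) := by
    rw [← Real.rpow_add hM0]
    congr 1
    ring
  calc |∑ j ∈ Finset.Icc 1 (2 * M), φ (((j : ℝ) - P) / D) * T j|
      = |∑ j ∈ S, φ (((j : ℝ) - P) / D) * T j| := by rw [hsum]
    _ ≤ ∑ j ∈ S, |φ (((j : ℝ) - P) / D) * T j| := Finset.abs_sum_le_sum_abs _ _
    _ ≤ ∑ j ∈ S, B * (max C₀ 0 * (M : ℝ) ^ (1 - κ)) := Finset.sum_le_sum hterm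
    _ = (S.card : ℝ) * (B * (max C₀ 0 * (M : ℝ) ^ (1 - κ))) := by
        rw [Finset.sum_const, nsmul_eq_mul]
    _ ≤ 6 * (M : ℝ) ^ (κ / 2) * (B * (max C₀ 0 * (M : ℝ) ^ (1 - κ))) :=
        mul_le_mul_of_nonneg_right hcard
          (mul_nonneg hB0 (mul_nonneg hC₀' (Real.rpow_nonneg hM0.le _)))
    _ = 6 * B * max C₀ 0 * (M : ℝ) ^ (3 / 4 + (1 / 4 - κ / 2)) := by
        rw [hpow]
        ring

end Summit.Parity.GeneralizedHardyLittlewood.Theorems.FanDecorrelation.NarrowOfPointwise
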